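import Mathlib
import HarnessLib

/-!
# Hasse-window arithmetic for level raising

For a natural number `p ≥ 2` we record the two elementary real-number facts behind the
"Hasse window" of the level-raising argument: the Deligne/Hasse bound `|a| ≤ 2√p` on a
weight-2 Hecke eigenvalue leaves the integer `ε(p+1) − a` nonzero because `2√p < p + 1`,
and its size is at most `p + 1 + 2√p = (1 + √p)²`.
-/

set_option linter.dupNamespace false

namespace Summit.ABC.ABC.Theorems.ReceptacleIdentitySketch

/-- **Hasse-window arithmetic.** For a natural number `p ≥ 2`:
* `2√p < p + 1` (equivalently `(√p − 1)² > 0`, which holds since `√p > 1`), and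
* `p + 1 + 2√p = (1 + √p)²` (expand and use `√p² = p`). -/
theorem stub_hasseWindowArith (p : ℕ) (hp : 2 ≤ p) :
    2 * Real.sqrt p < (p : ℝ) + 1 ∧ (p : ℝ) + 1 + 2 * Real.sqrt p = (1 + Real.sqrt p) ^ 2 := by
  have hp' : (2 : ℝ) ≤ (p : ℝ) := by exact_mod_cast hp
  have hsq : Real.sqrt (p : ℝ) ^ 2 = (p : ℝ) := Real.sq_sqrt (Nat.cast_nonneg p)
  have hone : (1 : ℝ) < Real.sqrt (p : ℝ) := by
    rw [show (1 : ℝ) = Real.sqrt 1 from Real.sqrt_one.symm]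
    exact Real.sqrt_lt_sqrt zero_le_one (by linarith)
  refine ⟨?_, ?_⟩
  · -- `(√p - 1)² > 0` since `√p > 1`, and `√p² = p`.
    nlinarith [mul_pos (sub_pos.mpr hone) (sub_pos.mpr hone), hsq]
  · -- expand `(1 + √p)²` and substitute `√p² = p`.
    nlinarith [hsq]

end Summit.ABC.ABC.Theorems.ReceptacleIdentitySketch
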